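import Literature.MathematicalPhysics.QuantumFieldTheory.Balaban1983to89.T3UpperLiftSplit
import Mathlib.Analysis.SpecificLimits.Normed
import HarnessLib

/-!
# `FluctuationComparisonRegPrIntLTailSupOneFarModulus` — LINE g21-2 «DEPTH-ONE WINDOW ODDS BY A MEASURE SPLIT»: THE MODULUS CLASS OF THE FAR REGIME WITH A
# `J`-DEPENDENT DELETED-PARTITION CONSTANT (`C_J ≤ A·e^{c(J+1)^k}` is absorbed by `e^{−β_{J+1}δ₀²∕4}`: the product is super-polynomially small)
# (crux `UnitScaleTilt.FluctuationComparisonRegPrIntL`, stmt-QuantumFields-20520; rows FPT ∕ FAR₁ of `Cruxes/…/Lines/tailsup_one.lean`, ideator ym-r3-idea-1 g21)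

Cell `ym3-torus` (YM ladder rung R3 = continuum SU(2) Yang–Mills on T³ — a RUNG, NOT the Clay problem: not d = 4, not infinite volume, not a mass gap);
width seat `ym3-torus-px20` (gen 10); helper `--supports stmt-QuantumFields-20520`.  THEOREMS ONLY (0 `def`, 0 `sorry`, default heartbeats).

WHY.  The far-plaquette door ✓`…TailSupOneFarPlaquetteCost.gibbsK_restrict_map_farPinned_le` (H §3) gives FPT's row with modulus `σ(J) = C·e^{−β_{J+1}δ₀²∕4}` from a
deleted-partition bound with constant `C`, and H §4 `superpoly_of_le_geometric_ratio` turns any GEOMETRIC majorant `A'·r^J` into TAILSUP's super-polynomial clause.  The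
line owner's reading of R3-FLIN (ideator g21, 2026-08-30 02:51Z, pointer (H)): on the full window the deleted-partition constant must be allowed to GROW with the level,
`C = C_J ≲ #Plaq_{J+1}·e^{c·L·p(g_J)²}` — i.e. `C_J ≤ A·e^{c'(J+1)^k}` for some `k` (the profile `p(g_J) = b₀(1 + log g_J⁻¹)^{p₀}` is polynomial in `J`, §2) — while
`β_{J+1} = L^{J+1}∕γ` (✓`T3UpperLiftSplit.scheme_β_eq`), so `σ(J) = C_J·e^{−δ₀²L^{J+1}∕(4γ)}` is still super-polynomially small: the double exponential beats `e^{poly(J)}`.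
This file is that absorption, once, so an FPT hand may deliver `C_J` of g21's class and cite the clause by name.
* §1 (pure real analysis) ★`tendsto_pow_mul_exp_neg_mul_pow` (`1 < L`, `0 < κ` ⇒ `(J+1)^m·e^{−κL^J} → 0`; `e^x ≥ x` + Mathlib `tendsto_pow_const_div_const_pow_of_one_lt`) ·
  ★`eventually_mul_pow_le_mul_pow` (`c·(J+1)^k ≤ ε·L^J` eventually, `ε > 0`) · ★★`superpoly_of_le_exp_poly_sub_pow` (`0 ≤ τ J ≤ A·exp(c·(J+1)^k − κ·L^J)` ⇒
  `∀ a, (J+1)^a·τ J → 0`).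
* §2 (tree letters) ★`one_add_log_inv_coupling_le` ∕ ★`pFun_coupling_le` (`0 < γ ≤ 1`, `1 ≤ L`, `0 ≤ b₀`, `0 ≤ p₀`: `pFun b₀ p₀ g_J ≤ b₀·(1 + ½log γ⁻¹ + ½log L)^{p₀}·(J+1)^{p₀}`,
  `g_J = √(γL^{−J})` — the profile is polynomial in the level) · ★★`farModulus_superpoly (F : T3Family) (hγ : 0 < γ) (hδ : 0 < δ₀) (hC0) (hC : C J ≤ A·exp(c·(J+1)^k)) :
  ∀ a, (J+1)^a·(C J·e^{−β_{J+1}δ₀²∕4}) → 0` — FPT's ∕ FAR₁'s modulus clause with a `J`-growing deleted-partition constant.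
HONEST SCOPE.  Real-analysis bookkeeping; the deleted-partition bound `C_J` (FPT's content: «one plaquette's four links stay pinned by their other plaquettes and the block
constraint», H∕I) is NOT touched; FPT, FAR₁, MOD₁∘, TAILSUP₁, LFR♯ᶜ, S2β, 20520, `YM3TorusSU2` NOT proved; the Yang–Mills mass gap is NOT proved.
References: [Balaban1985UV3] (3) p. 256 (`g_k² = g²L^kε`), (7) p. 257 (the profile `p(g)`), (67)–(71) p. 273 (large-field factors); [Balaban1987RG1] (0.2) p. 252.
-/

noncomputable section

set_option autoImplicit false

open Filter Topology Set
open scoped BigOperators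
open Literature.MathematicalPhysics.QuantumFieldTheory.Balaban1983to89
open Literature.MathematicalPhysics.QuantumFieldTheory.Balaban1983to89.T3ContinuumYM3Torus
open Literature.MathematicalPhysics.QuantumFieldTheory.Balaban1983to89.T3UnitLawDensityEML

namespace Summit.QuantumFields.YangMills.Theorems.FluctuationComparisonRegPrIntLTailSupOneFarModulus

/-! ## §1 Pure real analysis: `e^{poly(J)}·e^{−κL^J}` is super-polynomially small -/

section Real

/-- ★ **`(J+1)^m·e^{−κL^J} → 0`** for `1 < L`, `0 < κ`: `e^{κL^J} ≥ κL^J`, so the term is `≤ κ⁻¹·L·(J+1)^m∕L^{J+1}`, and Mathlib's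
`tendsto_pow_const_div_const_pow_of_one_lt` (shifted by one) finishes. [folklore] -/
theorem tendsto_pow_mul_exp_neg_mul_pow {L κ : ℝ} (hL : 1 < L) (hκ : 0 < κ) (m : ℕ) :
    Tendsto (fun J : ℕ => ((J : ℝ) + 1) ^ m * Real.exp (-(κ * L ^ J))) atTop (𝓝 0) := by
  have hL0 : 0 < L := lt_trans zero_lt_one hL
  -- the shifted polynomial-over-geometric limit
  have h1 : Tendsto (fun J : ℕ => (((J + 1 : ℕ) : ℝ)) ^ m / L ^ (J + 1)) atTop (𝓝 0) :=
    (tendsto_pow_const_div_const_pow_of_one_lt m hL).comp (tendsto_add_atTop_nat 1)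
  have h2 : Tendsto (fun J : ℕ => (κ⁻¹ * L) * ((((J + 1 : ℕ) : ℝ)) ^ m / L ^ (J + 1))) atTop (𝓝 0) := by
    simpa using h1.const_mul (κ⁻¹ * L)
  refine squeeze_zero (fun J => by positivity) (fun J => ?_) h2
  -- `(J+1)^m e^{−κL^J} ≤ (J+1)^m / (κ L^J) = κ⁻¹ L (J+1)^m / L^{J+1}`
  have hLJ : 0 < L ^ J := pow_pos hL0 J
  have hexp : Real.exp (-(κ * L ^ J)) ≤ (κ * L ^ J)⁻¹ := by
    rw [Real.exp_neg]
    exact inv_anti₀ (mul_pos hκ hLJ) ((le_add_of_nonneg_right zero_le_one).trans (Real.add_one_le_exp _))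
  have hcast : (((J + 1 : ℕ) : ℝ)) = (J : ℝ) + 1 := by push_cast; ring
  calc ((J : ℝ) + 1) ^ m * Real.exp (-(κ * L ^ J)) ≤ ((J : ℝ) + 1) ^ m * (κ * L ^ J)⁻¹ :=
        mul_le_mul_of_nonneg_left hexp (by positivity)
    _ = (κ⁻¹ * L) * ((((J + 1 : ℕ) : ℝ)) ^ m / L ^ (J + 1)) := by
        rw [hcast, pow_succ]
        field_simp

/-- ★ **A POLYNOMIAL IS EVENTUALLY BELOW ANY POSITIVE MULTIPLE OF `L^J`**: `1 < L`, `0 < ε` ⇒ eventually `c·(J+1)^k ≤ ε·L^J`. [folklore] -/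
theorem eventually_mul_pow_le_mul_pow {L ε : ℝ} (hL : 1 < L) (hε : 0 < ε) (c : ℝ) (k : ℕ) :
    ∀ᶠ J : ℕ in atTop, c * ((J : ℝ) + 1) ^ k ≤ ε * L ^ J := by
  have hL0 : 0 < L := lt_trans zero_lt_one hL
  -- `(J+1)^k / L^J → 0`, hence eventually `≤ ε / max c 1`
  have h1 : Tendsto (fun J : ℕ => (((J + 1 : ℕ) : ℝ)) ^ k / L ^ (J + 1)) atTop (𝓝 0) :=
    (tendsto_pow_const_div_const_pow_of_one_lt k hL).comp (tendsto_add_atTop_nat 1)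
  have h2 : Tendsto (fun J : ℕ => L * ((((J + 1 : ℕ) : ℝ)) ^ k / L ^ (J + 1))) atTop (𝓝 0) := by
    simpa using h1.const_mul L
  have hq : 0 < ε / max c 1 := div_pos hε (lt_of_lt_of_le zero_lt_one (le_max_right _ _))
  filter_upwards [(tendsto_order.1 h2).2 _ hq] with J hJ
  have hcast : (((J + 1 : ℕ) : ℝ)) = (J : ℝ) + 1 := by push_cast; ring
  have hLJ : 0 < L ^ J := pow_pos hL0 J
  have hid : L * ((((J + 1 : ℕ) : ℝ)) ^ k / L ^ (J + 1)) = ((J : ℝ) + 1) ^ k / L ^ J := by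
    rw [hcast, pow_succ]
    field_simp
  rw [hid] at hJ
  -- `(J+1)^k ≤ (ε / max c 1)·L^J`, and `c ≤ max c 1`
  have h3 : ((J : ℝ) + 1) ^ k ≤ ε / max c 1 * L ^ J := by
    have := (div_lt_iff₀ hLJ).mp hJ
    exact this.le
  have hmax : 0 < max c 1 := lt_of_lt_of_le zero_lt_one (le_max_right _ _)
  calc c * ((J : ℝ) + 1) ^ k ≤ max c 1 * ((J : ℝ) + 1) ^ k := mul_le_mul_of_nonneg_right (le_max_left _ _) (by positivity)
    _ ≤ max c 1 * (ε / max c 1 * L ^ J) := mul_le_mul_of_nonneg_left h3 hmax.le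
    _ = ε * L ^ J := by field_simp

/-- ★★ **SUPER-POLYNOMIAL SMALLNESS FROM AN `e^{poly − κL^J}` MAJORANT**: `0 ≤ τ J ≤ A·exp(c·(J+1)^k − κ·L^J)` with `1 < L`, `0 < κ` ⇒ for every `a`,
`(J+1)^a·τ J → 0` (TAILSUP's modulus clause). [folklore] -/
theorem superpoly_of_le_exp_poly_sub_pow {L κ A c : ℝ} (hL : 1 < L) (hκ : 0 < κ) {k : ℕ} {τ : ℕ → ℝ} (h0 : ∀ J, 0 ≤ τ J)
    (hle : ∀ J, τ J ≤ A * Real.exp (c * ((J : ℝ) + 1) ^ k - κ * L ^ J)) (a : ℕ) :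
    Tendsto (fun J : ℕ => ((J : ℝ) + 1) ^ a * τ J) atTop (𝓝 0) := by
  have hA : 0 ≤ A := by
    have h := (h0 0).trans (hle 0)
    exact nonneg_of_mul_nonneg_left (by simpa using h) (Real.exp_pos _)
  -- eventually `c (J+1)^k ≤ (κ/2) L^J`, so `τ J ≤ A e^{−(κ/2) L^J}`
  have hev := eventually_mul_pow_le_mul_pow hL (half_pos hκ) c k
  have hlim : Tendsto (fun J : ℕ => A * (((J : ℝ) + 1) ^ a * Real.exp (-(κ / 2 * L ^ J)))) atTop (𝓝 0) := by
    simpa using (tendsto_pow_mul_exp_neg_mul_pow hL (half_pos hκ) a).const_mul A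
  refine squeeze_zero' (Eventually.of_forall fun J => mul_nonneg (by positivity) (h0 J)) ?_ hlim
  filter_upwards [hev] with J hJ
  have hexp : Real.exp (c * ((J : ℝ) + 1) ^ k - κ * L ^ J) ≤ Real.exp (-(κ / 2 * L ^ J)) :=
    Real.exp_le_exp.mpr (by linarith)
  calc ((J : ℝ) + 1) ^ a * τ J ≤ ((J : ℝ) + 1) ^ a * (A * Real.exp (-(κ / 2 * L ^ J))) :=
        mul_le_mul_of_nonneg_left ((hle J).trans (mul_le_mul_of_nonneg_left hexp hA)) (by positivity)
    _ = A * (((J : ℝ) + 1) ^ a * Real.exp (-(κ / 2 * L ^ J))) := by ring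

end Real

/-! ## §2 In the tree's letters: the profile is polynomial in the level; FPT's modulus with a `J`-growing constant is super-polynomially small -/

section Tree

/-- ★ **THE LOG OF THE INVERSE COUPLING IS LINEAR IN THE LEVEL**: `0 < γ ≤ 1`, `1 ≤ L` ⇒ `1 + log (g_J)⁻¹ ≤ (1 + ½·log γ⁻¹ + ½·log L)·(J+1)` with `g_J = √(γ·L^{−J})`
(`log g_J⁻¹ = ½(J·log L + log γ⁻¹)`). [cite: Balaban1985UV3, (3) p.256 and (7) p.257] -/
theorem one_add_log_inv_coupling_le {Lfam : ℕ} (hL : 1 ≤ Lfam) {γ : ℝ} (hγ : 0 < γ) (hγ1 : γ ≤ 1) (J : ℕ) :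
    1 + Real.log (Real.sqrt (γ * ((Lfam : ℝ)⁻¹) ^ J))⁻¹ ≤
      (1 + Real.log γ⁻¹ / 2 + Real.log Lfam / 2) * ((J : ℝ) + 1) := by
  have hLpos : (0 : ℝ) < Lfam := by exact_mod_cast hL
  have hLge : (1 : ℝ) ≤ Lfam := by exact_mod_cast hL
  have hx : 0 < γ * ((Lfam : ℝ)⁻¹) ^ J := mul_pos hγ (pow_pos (inv_pos.mpr hLpos) J)
  -- `log (√x)⁻¹ = −½ log x = ½ (J log L − log γ)`
  have hlog : Real.log (Real.sqrt (γ * ((Lfam : ℝ)⁻¹) ^ J))⁻¹ = (J * Real.log Lfam + Real.log γ⁻¹) / 2 := by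
    rw [Real.log_inv, Real.log_sqrt hx.le, Real.log_mul hγ.ne' (pow_pos (inv_pos.mpr hLpos) J).ne', Real.log_pow, Real.log_inv,
      Real.log_inv]
    ring
  rw [hlog]
  have hlogL : 0 ≤ Real.log Lfam := Real.log_nonneg hLge
  have hlogγ : 0 ≤ Real.log γ⁻¹ := Real.log_nonneg ((one_le_inv₀ hγ).mpr hγ1)
  have hJ : (0 : ℝ) ≤ J := Nat.cast_nonneg J
  nlinarith [mul_nonneg hlogγ hJ, mul_nonneg hlogL hJ]

/-- ★ **THE PROFILE IS POLYNOMIAL IN THE LEVEL**: `0 < γ ≤ 1`, `1 ≤ L`, `0 ≤ b₀`, `0 ≤ p₀` ⇒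
`pFun b₀ p₀ g_J ≤ b₀·(1 + ½·log γ⁻¹ + ½·log L)^{p₀}·(J+1)^{p₀}` (`pFun b₀ p₀ g = b₀(1 + log g⁻¹)^{p₀}`, monotonicity of `rpow`, `Real.mul_rpow`).
[cite: Balaban1985UV3, (7) p.257] -/
theorem pFun_coupling_le {Lfam : ℕ} (hL : 1 ≤ Lfam) {γ b₀ p₀ : ℝ} (hγ : 0 < γ) (hγ1 : γ ≤ 1) (hb₀ : 0 ≤ b₀) (hp₀ : 0 ≤ p₀) (J : ℕ) :
    B10.pFun b₀ p₀ (Real.sqrt (γ * ((Lfam : ℝ)⁻¹) ^ J)) ≤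
      b₀ * ((1 + Real.log γ⁻¹ / 2 + Real.log Lfam / 2) ^ p₀ * (((J : ℝ) + 1) ^ p₀)) := by
  have hLpos : (0 : ℝ) < Lfam := by exact_mod_cast hL
  have hLge : (1 : ℝ) ≤ Lfam := by exact_mod_cast hL
  have h1 := one_add_log_inv_coupling_le hL hγ hγ1 J
  -- the base `1 + log g⁻¹` is `≥ 1 ≥ 0` since `g_J ≤ 1`
  have hg : 0 < Real.sqrt (γ * ((Lfam : ℝ)⁻¹) ^ J) := Real.sqrt_pos.mpr (mul_pos hγ (pow_pos (inv_pos.mpr hLpos) J))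
  have hLinv : ((Lfam : ℝ)⁻¹) ^ J ≤ 1 := pow_le_one₀ (inv_nonneg.mpr hLpos.le) (inv_le_one_of_one_le₀ hLge)
  have hg1 : Real.sqrt (γ * ((Lfam : ℝ)⁻¹) ^ J) ≤ 1 := by
    rw [← Real.sqrt_one]
    exact Real.sqrt_le_sqrt (by nlinarith [pow_nonneg (inv_nonneg.mpr hLpos.le) J])
  have hbase : 0 ≤ 1 + Real.log (Real.sqrt (γ * ((Lfam : ℝ)⁻¹) ^ J))⁻¹ := by
    have : 0 ≤ Real.log (Real.sqrt (γ * ((Lfam : ℝ)⁻¹) ^ J))⁻¹ := Real.log_nonneg ((one_le_inv₀ hg).mpr hg1)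
    linarith
  have hM : 0 ≤ 1 + Real.log γ⁻¹ / 2 + Real.log Lfam / 2 := by
    have hlogL : 0 ≤ Real.log Lfam := Real.log_nonneg hLge
    have hlogγ : 0 ≤ Real.log γ⁻¹ := Real.log_nonneg ((one_le_inv₀ hγ).mpr hγ1)
    positivity
  unfold B10.pFun
  refine mul_le_mul_of_nonneg_left ?_ hb₀
  rw [← Real.mul_rpow hM (by positivity)]
  exact Real.rpow_le_rpow hbase h1 hp₀

/-- ★★ **FPT's ∕ FAR₁'s MODULUS WITH A `J`-GROWING DELETED-PARTITION CONSTANT IS SUPER-POLYNOMIALLY SMALL**: for a block family `F` (so `1 < F.L`), `0 < γ`, `0 < δ₀`,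
and constants `0 ≤ C J ≤ A·exp(c·(J+1)^k)` (g21's class `C_J ≲ #Plaq_{J+1}·e^{cL·p(g_J)²}` is of this form by `pFun_coupling_le`), the far modulus
`σ(J) = C J·e^{−β_{J+1}δ₀²∕4}`, `β_{J+1} = L^{J+1}∕γ` (✓`scheme_β_eq`), satisfies TAILSUP's clause `∀ a, (J+1)^a·σ(J) → 0`.
[cite: Balaban1985UV3, (3) p.256 and (67)-(71) p.273] -/
theorem farModulus_superpoly (F : T3Family) {γ δ₀ : ℝ} (hγ : 0 < γ) (hδ : 0 < δ₀) {C : ℕ → ℝ} {A c : ℝ} {k : ℕ}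
    (hC0 : ∀ J, 0 ≤ C J) (hC : ∀ J, C J ≤ A * Real.exp (c * ((J : ℝ) + 1) ^ k)) (a : ℕ) :
    Tendsto (fun J : ℕ => ((J : ℝ) + 1) ^ a * (C J * Real.exp (-((F.scheme ℰp γ).β (J + 1) * δ₀ ^ 2 / 4)))) atTop (𝓝 0) := by
  have hL1 : (1 : ℝ) < F.L := by exact_mod_cast F.hL.2
  have hL0 : (0 : ℝ) < F.L := lt_trans zero_lt_one hL1
  -- `β_{J+1} δ₀²/4 = κ · L^J` with `κ = δ₀² L / (4 γ)`
  have hβ : ∀ J : ℕ, (F.scheme ℰp γ).β (J + 1) * δ₀ ^ 2 / 4 = (δ₀ ^ 2 * F.L / (4 * γ)) * (F.L : ℝ) ^ J := by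
    intro J
    rw [T3UpperLiftSplit.scheme_β_eq, inv_pow, mul_inv, inv_inv, pow_succ]
    field_simp
  have hκ : 0 < δ₀ ^ 2 * (F.L : ℝ) / (4 * γ) := by positivity
  refine superpoly_of_le_exp_poly_sub_pow (A := A) (c := c) (k := k) hL1 hκ (fun J => mul_nonneg (hC0 J) (Real.exp_pos _).le)
    (fun J => ?_) a
  rw [hβ J, Real.exp_sub]
  rw [Real.exp_neg]
  have hE : 0 < Real.exp (δ₀ ^ 2 * ↑F.L / (4 * γ) * ↑F.L ^ J) := Real.exp_pos _
  calc C J * (Real.exp (δ₀ ^ 2 * ↑F.L / (4 * γ) * ↑F.L ^ J))⁻¹ ≤ (A * Real.exp (c * ((J : ℝ) + 1) ^ k)) * (Real.exp (δ₀ ^ 2 * ↑F.L / (4 * γ) * ↑F.L ^ J))⁻¹ :=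
        mul_le_mul_of_nonneg_right (hC J) (inv_nonneg.mpr hE.le)
    _ = A * (Real.exp (c * ((J : ℝ) + 1) ^ k) / Real.exp (δ₀ ^ 2 * ↑F.L / (4 * γ) * ↑F.L ^ J)) := by
        simp only [div_eq_mul_inv, mul_assoc]

end Tree

end Summit.QuantumFields.YangMills.Theorems.FluctuationComparisonRegPrIntLTailSupOneFarModulus

end
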